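import Literature.NumberTheory.LFunctions.Zhang2022.Section8MainTerms
import Literature.NumberTheory.LFunctions.Zhang2022.Section8ClosedForm
import Literature.NumberTheory.LFunctions.Zhang2022.Section18Defs

/-!
# Zhang (2022) Appendix B: the residues behind Lemma 15.1, and the derived value of (B.3)

Trunk T-ANT (NumberTheory/LFunctions). Companion of `Section18Defs.lean`, `Section18Certificate.lean`
and `Section8MainTerms.lean` (Y. Zhang, *Discrete mean estimates and the Landau–Siegel zero*,
arXiv:2211.02515v1 (2022) [Zhang2022LandauSiegel]; Appendix B "Some arithmetic sums" = the proof of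
Lemma 15.1, p. 39, and the statement of Lemma 15.1, p. 31; **an unrefereed manuscript, a claimed
result under adjudication** — this file reproduces finite computations of the manuscript (residue
calculus and first-year calculus) and asserts nothing about its theorems).

What is kernel-checked here:

1. **The residue sum of Appendix B.** For `μ = 2` the proof of Lemma 15.1 writes
   `Σ_l 𝔳𝔨₂(l₁l)ϱ_j(l)/l = (2πi)⁻¹∫_{(1)} ζ(1+s)/ζ(1+s−β_j) · (P₂/l₁)ˢ/((log P₂)(s − β₇)²) ds`, says the
   right side "is equal to the sum of the residues of the integrand at `s = 0` and `s = β₇` plus an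
   acceptable error", and displays: "the residue at `s = 0` is `−β_j/(β₇² log P₂) = −8j/(25πi) + O(α₁)`;
   the residue at `s = β₇` is, by the Cauchy integral formula, `… = (1 − 2j/5 + 8j/(25πi)) exp{5πi/4}
   + O(α₁)`"; then "in case `μ = 3` … with `β₆` and `P₃` in place of `β₇` and `P₂`" and "the same
   argument also gives" the `μ = 1` value `(1 − 2j/3 + j/(1.134πi)) exp{0.756πi} − j/(1.134πi)`.
   With the polar main part `ζ(1+s)/ζ(1+s−β_j) ↦ (s − β_j)/s` (the same convention as
   `Section8MainTerms`, where `L(1 − β_j + s, χ) ↦ L′(1,χ)(s − β_j)`), `l₁ = 1` and `P_μˢ = e^{sL}`,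
   `L = log P_μ`, the integrand is `e^{sL}(s − b)/(L·s·(s − β)²)` (`b = β_j`, `β = β₇` or `β₆`).
   `circleIntegral_appB` PROVES, for ANY circle containing `0` and `β` (`β ≠ 0`, `L ≠ 0`):
   `(2πi)⁻¹ ∮ e^{sL}(s − b)/(L s (s − β)²) ds = appBMain b β L := (1 − b/β + b/(Lβ²))e^{βL} − b/(Lβ²)`
   (partial fractions `A/s + B/(s − β) + C/(s − β)²`, `A = −b/(Lβ²)`, `B = −A`, `C = (β − b)/(Lβ)`,
   then Cauchy's formula at `0`, at `β`, and Cauchy's formula for the derivative at `β`); the two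
   summands `appBResBeta`, `appBResZero` are the two displayed residues.
2. **Lemma 15.1's printed `e_{2j}, e_{3j}, e′_{1j}` ARE these residue sums at the main values**
   `β_j⁰ = jiα` ((2.13)), `β₆ = 3iα/2`, `β₇ = 5iα/2` ((2.22)), `log P₁ = 0.504 log P`,
   `log P₂ = 0.5 log P` (main part of `P₂ = P^{1/2}T^{−10}`), `log P₃ = 0.498 log P` ((2.21)),
   `α log P = π` ((2.10)): `appBMain_main_e1pj/e2j/e3j` PROVE `appBMain β_j β₆ (0.504 log P) = e′_{1j}`,
   `appBMain β_j β₇ (0.5 log P) = e_{2j}`, `appBMain β_j β₆ (0.498 log P) = e_{3j}` EXACTLY for every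
   `j`, with `e1pj, e2j, e3j` the printed definitions transcribed in `Section18Defs`
   (`appBResZero_main_mu2`, `appBResBeta_main_mu2` are the two displayed `μ = 2` residues);
   `appB_main_e1pj/e2j/e3j` combine 1–2 on the manuscript's circle `|s| = 5α`. So the printed
   constants — `8/25`, `5/4`, `1.1205 = (3/2)²·0.498`, `0.747`, `1.134 = (3/2)²·0.504`, `0.756` — are
   the correct residue sums (consistent with STEPS X15.1 / XB.e of the adjudication record).
3. **Window averages** (the "theoretical interpretation" alluded to in §18). `integral_ffF_closed`
   PROVES the closed form of `∫₀ᴸ 𝔣𝔣_{a,k}` and `e1pj_eq_average`, `e3j_eq_average`, `e2j_eq_average`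
   PROVE that the three constants are the AVERAGES of the §8 profiles over the windows of (4.1)–(4.3):
   `e′_{1j} = (1/0.504)∫₀^{0.504} 𝔣𝔣_{j6}`, `e_{3j} = (1/0.498)∫₀^{0.498} 𝔣𝔣_{j6}`,
   `e_{2j} = (1/0.5)∫₀^{0.5} 𝔣𝔣_{j7}`, `𝔣𝔣_{j6} = ffF (3/2 − j) (3/2)`, `𝔣𝔣_{j7} = ffF (5/2 − j) (5/2)`
   ((8.13)–(8.18)). These feed the exact form of the `ε`-identity of §18
   (`Section18EpsilonIdentity.lean`).
4. **(B.3), the value the proof derives.** The proof of (B.3) ENDS with the display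
   `(1/0.504)(β_j/β₆)∫_{0.5}^{0.504}(P^{β₆(0.504−z)} − P^{0.004β₆})dz + O(α₁)`. At the main values this
   is `e1ppD j := (1/0.504)(2j/3)∫_{0.5}^{0.504}(e^{(3/2)(0.504−z)πi} − e^{(3/2)(0.004)πi})dz`
   (`appB3_main`), and `e1ppD_eq` PROVES `e1ppD j = −jπi·b*` EXACTLY (`b*` of (12.10), `bstar`;
   substitution `z ↦ 0.504 − z` and one integration by parts). The STATED right side of (B.3) =
   Lemma 15.1's printed `e″_{1j} = (j/0.756)∫₀^{0.004}(e^{(3/2)(0.504−z)πi} − e^{(3/4)πi})dz` (`e1ppj`)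
   is a different number (`Section18EpsilonIdentity`: `|e″₁₁(printed) − e″₁₁(derived)| > 3.8·10⁻⁵`,
   both of size `≈ 5·10⁻⁵`); this file proves identities only and does not adjudicate which the author
   intended. NEITHER reading affects the cell's verdict (`Section8Certificate.not_ineq824`;
   `Section18Certificate.not_ineq18sum_robust` covers every `|ε| ≤ 0.027`).

Not touched: (B.1), (B.2) (the arithmetic estimates `≪ ℒ⁻⁸`), the contour shift "in a way similar to
the proof of Lemma 8.1", all error terms `O(α₁)`, and the replacement of `ζ(1+s)/ζ(1+s−β_j)` and of
`(P₂/l₁)ˢ` by their main parts.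
-/

noncomputable section

open Complex Real Metric Set

namespace Literature.NumberTheory.LFunctions.Zhang2022

/-! ### Appendix B: the residue sum -/

/-- Residue of `e^{sL}(s − b)/(L·s·(s − β)²)` at the double pole `s = β`:
`(1 − b/β + b/(Lβ²)) e^{βL}` (printed for `μ = 2`: `(1 − 2j/5 + 8j/(25πi)) exp{5πi/4}`).
[cite: Zhang2022LandauSiegel, Appendix B (proof of Lemma 15.1)] -/
def appBResBeta (b β L : ℂ) : ℂ := (1 - b / β + b / (L * β ^ 2)) * cexp (β * L)

/-- Residue of `e^{sL}(s − b)/(L·s·(s − β)²)` at `s = 0`: `−b/(Lβ²)` (printed: "the residue at `s = 0`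
is `−β_j/(β₇² log P₂) = −8j/(25πi) + O(α₁)`"). [cite: Zhang2022LandauSiegel, Appendix B] -/
def appBResZero (b β L : ℂ) : ℂ := -(b / (L * β ^ 2))

/-- The residue sum of Appendix B as a function of the shift `b = β_j`, the double pole
`β ∈ {β₆, β₇}` and `L = log P_μ`: `appBMain b β L = (1 − b/β + b/(Lβ²)) e^{βL} − b/(Lβ²)`.
[cite: Zhang2022LandauSiegel, Appendix B (proof of Lemma 15.1)] -/
def appBMain (b β L : ℂ) : ℂ := (1 - b / β + b / (L * β ^ 2)) * cexp (β * L) - b / (L * β ^ 2)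

/-- `appBMain = appBResBeta + appBResZero`. [cite: Zhang2022LandauSiegel, Appendix B] -/
theorem appBMain_eq_residues (b β L : ℂ) :
    appBMain b β L = appBResBeta b β L + appBResZero b β L := by
  unfold appBMain appBResBeta appBResZero; ring

/-- **Appendix B's residue computation.** For any circle `C(c, R)` containing `0` and `β`
(`β ≠ 0`, `L ≠ 0`):
`(2πi)⁻¹ ∮ e^{sL}(s − b)/(L·s·(s − β)²) ds = (1 − b/β + b/(Lβ²)) e^{βL} − b/(Lβ²)`.
Proof: partial fractions `(s − b)/(L s (s − β)²) = A/s + B/(s − β) + C/(s − β)²` with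
`A = −b/(Lβ²)`, `B = b/(Lβ²)`, `C = (β − b)/(Lβ)` (valid on the circle, where `s ≠ 0, β`), then
Cauchy's formula at `0` and at `β` and Cauchy's formula for the derivative at `β` (Mathlib):
`A·1 + B e^{βL} + C·L e^{βL}`. The manuscript's circle/contour is not specified beyond "in a way
similar to the proof of Lemma 8.1"; the residue sum is contour-independent.
[cite: Zhang2022LandauSiegel, Appendix B (proof of Lemma 15.1)] -/
theorem circleIntegral_appB (b β L : ℂ) {c : ℂ} {R : ℝ} (h0 : (0 : ℂ) ∈ ball c R)
    (hβ : β ∈ ball c R) (hβ0 : β ≠ 0) (hL : L ≠ 0) :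
    (2 * π * I)⁻¹ * (∮ s in C(c, R), cexp (s * L) * (s - b) / (L * s * (s - β) ^ 2))
      = appBMain b β L := by
  have hR : 0 < R := pos_of_mem_ball hβ
  set f : ℂ → ℂ := fun s => cexp (s * L) with hf_def
  have hf : Differentiable ℂ f := fun s => ((differentiable_id.mul_const L).cexp) s
  set A : ℂ := -(b / (L * β ^ 2)) with hA
  set B : ℂ := b / (L * β ^ 2) with hB
  set C : ℂ := (β - b) / (L * β) with hC
  have hne0 : ∀ s ∈ sphere c R, s - 0 ≠ 0 := fun s hs h =>
    (sphere_disjoint_ball.ne_of_mem hs h0) (sub_eq_zero.mp h)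
  have hneβ : ∀ s ∈ sphere c R, s - β ≠ 0 := fun s hs h =>
    (sphere_disjoint_ball.ne_of_mem hs hβ) (sub_eq_zero.mp h)
  have hcongr : EqOn (fun s => cexp (s * L) * (s - b) / (L * s * (s - β) ^ 2))
      (fun s => A * ((s - 0)⁻¹ * f s) + (B * ((s - β)⁻¹ * f s)
        + C * (((s - β) ^ 2)⁻¹ * f s))) (sphere c R) := by
    intro s hs
    have h1 := hne0 s hs
    have h2 := hneβ s hs
    rw [sub_zero] at h1
    simp only [hf_def, hA, hB, hC, sub_zero]
    field_simp
    ring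
  rw [circleIntegral.integral_congr hR.le hcongr]
  have hc0 : ContinuousOn (fun s : ℂ => (s - 0)⁻¹) (sphere c R) :=
    (continuousOn_id.sub continuousOn_const).inv₀ hne0
  have hc1 : ContinuousOn (fun s : ℂ => (s - β)⁻¹) (sphere c R) :=
    (continuousOn_id.sub continuousOn_const).inv₀ hneβ
  have hc2 : ContinuousOn (fun s : ℂ => ((s - β) ^ 2)⁻¹) (sphere c R) :=
    ((continuousOn_id.sub continuousOn_const).pow 2).inv₀ (fun s hs => pow_ne_zero 2 (hneβ s hs))
  have hfc : ContinuousOn f (sphere c R) := hf.continuous.continuousOn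
  have hi0 : CircleIntegrable (fun s => A * ((s - 0)⁻¹ * f s)) c R :=
    (continuousOn_const.mul (hc0.mul hfc)).circleIntegrable hR.le
  have hi1 : CircleIntegrable (fun s => B * ((s - β)⁻¹ * f s)) c R :=
    (continuousOn_const.mul (hc1.mul hfc)).circleIntegrable hR.le
  have hi2 : CircleIntegrable (fun s => C * (((s - β) ^ 2)⁻¹ * f s)) c R :=
    (continuousOn_const.mul (hc2.mul hfc)).circleIntegrable hR.le
  have hi12 : CircleIntegrable (fun s => B * ((s - β)⁻¹ * f s)
      + C * (((s - β) ^ 2)⁻¹ * f s)) c R := hi1.add hi2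
  rw [circleIntegral.integral_add hi0 hi12, circleIntegral.integral_add hi1 hi2,
    circleIntegral.integral_const_mul, circleIntegral.integral_const_mul,
    circleIntegral.integral_const_mul]
  have hv0 : (2 * π * I)⁻¹ * (∮ s in C(c, R), (s - 0)⁻¹ * f s) = f 0 := by
    have := (hf.diffContOnCl (s := ball c R)).two_pi_i_inv_smul_circleIntegral_sub_inv_smul h0
    simpa only [smul_eq_mul] using this
  have hv1 : (2 * π * I)⁻¹ * (∮ s in C(c, R), (s - β)⁻¹ * f s) = f β := by
    have := (hf.diffContOnCl (s := ball c R)).two_pi_i_inv_smul_circleIntegral_sub_inv_smul hβ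
    simpa only [smul_eq_mul] using this
  have hv2 : (2 * π * I)⁻¹ * (∮ s in C(c, R), ((s - β) ^ 2)⁻¹ * f s) = deriv f β := by
    have := Complex.two_pi_I_inv_smul_circleIntegral_sub_sq_inv_smul_of_differentiable
      isOpen_univ (subset_univ _) hf.differentiableOn hβ
    simpa only [smul_eq_mul] using this
  have hderiv : deriv f β = L * cexp (β * L) := by
    have : HasDerivAt f (cexp (β * L) * (1 * L)) β :=
      (Complex.hasDerivAt_exp (β * L)).comp β ((hasDerivAt_id β).mul_const L)
    rw [this.deriv]; ring
  have hf0 : f 0 = 1 := by simp [hf_def]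
  have hfβ : f β = cexp (β * L) := by simp [hf_def]
  calc (2 * π * I)⁻¹ * (A * (∮ s in C(c, R), (s - 0)⁻¹ * f s)
          + (B * (∮ s in C(c, R), (s - β)⁻¹ * f s) + C * ∮ s in C(c, R), ((s - β) ^ 2)⁻¹ * f s))
      = A * f 0 + B * f β + C * deriv f β := by rw [← hv0, ← hv1, ← hv2]; ring
    _ = appBMain b β L := by
        rw [hderiv, hf0, hfβ]; simp only [hA, hB, hC, appBMain]; field_simp; ring

/-! ### The main values: Lemma 15.1's `e′_{1j}`, `e_{2j}`, `e_{3j}` -/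

section MainValues

variable {α Λ : ℝ}

/-- `μ = 1` (window `P₁ = P^{0.504}`, pole `β₆ = 3iα/2`): at the main values `β_j⁰ = jiα`, `α log P = π`,
the residue sum is Lemma 15.1's printed `e′_{1j}`: `b/β = 2j/3`, `βL = 0.756πi`,
`b/(Lβ²) = j/(1.134πi)` (`1.134 = (3/2)²·0.504`).
[cite: Zhang2022LandauSiegel, Appendix B ("the same argument also gives"), Lemma 15.1] -/
theorem appBMain_main_e1pj (hα : α ≠ 0) (h : α * Λ = π) (j : ℕ) :
    appBMain (betaMain j α) (betaMain (3/2) α) ((0.504 : ℂ) * Λ) = e1pj j := by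
  have hπ : (π : ℂ) = (α : ℂ) * Λ := by rw [← Complex.ofReal_mul, h]
  have hα' : (α : ℂ) ≠ 0 := by exact_mod_cast hα
  have hΛ : Λ ≠ 0 := by intro hz; rw [hz, mul_zero] at h; exact Real.pi_ne_zero h.symm
  have hΛ' : (Λ : ℂ) ≠ 0 := by exact_mod_cast hΛ
  have hI : I ≠ 0 := I_ne_zero
  have hE : cexp (betaMain (3/2) α * ((0.504 : ℂ) * Λ)) = cexp (0.756 * π * I) := by
    congr 1; unfold betaMain; rw [hπ]; push_cast; ring
  unfold appBMain
  rw [hE]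
  unfold e1pj betaMain
  rw [hπ]
  generalize cexp (0.756 * ((α : ℂ) * Λ) * I) = w
  push_cast
  field_simp
  ring

/-- `μ = 2` (window `P₂`, main part `P^{0.5}`, pole `β₇ = 5iα/2`): the residue sum at the main values is
Lemma 15.1's printed `e_{2j}`: `b/β = 2j/5`, `βL = 5πi/4`, `b/(Lβ²) = 8j/(25πi)`.
[cite: Zhang2022LandauSiegel, Appendix B, Lemma 15.1] -/
theorem appBMain_main_e2j (hα : α ≠ 0) (h : α * Λ = π) (j : ℕ) :
    appBMain (betaMain j α) (betaMain (5/2) α) ((0.5 : ℂ) * Λ) = e2j j := by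
  have hπ : (π : ℂ) = (α : ℂ) * Λ := by rw [← Complex.ofReal_mul, h]
  have hα' : (α : ℂ) ≠ 0 := by exact_mod_cast hα
  have hΛ : Λ ≠ 0 := by intro hz; rw [hz, mul_zero] at h; exact Real.pi_ne_zero h.symm
  have hΛ' : (Λ : ℂ) ≠ 0 := by exact_mod_cast hΛ
  have hI : I ≠ 0 := I_ne_zero
  have hE : cexp (betaMain (5/2) α * ((0.5 : ℂ) * Λ)) = cexp (5 * π * I / 4) := by
    congr 1; unfold betaMain; rw [hπ]; push_cast; ring
  unfold appBMain
  rw [hE]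
  unfold e2j betaMain
  rw [hπ]
  generalize cexp (5 * ((α : ℂ) * Λ) * I / 4) = w
  push_cast
  field_simp
  ring

/-- `μ = 3` (window `P₃ = P^{0.498}`, pole `β₆`): the residue sum at the main values is Lemma 15.1's
printed `e_{3j}`: `b/β = 2j/3`, `βL = 0.747πi`, `b/(Lβ²) = j/(1.1205πi)` (`1.1205 = (3/2)²·0.498`).
[cite: Zhang2022LandauSiegel, Appendix B ("with β₆ and P₃ in place of β₇ and P₂"), Lemma 15.1] -/
theorem appBMain_main_e3j (hα : α ≠ 0) (h : α * Λ = π) (j : ℕ) :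
    appBMain (betaMain j α) (betaMain (3/2) α) ((0.498 : ℂ) * Λ) = e3j j := by
  have hπ : (π : ℂ) = (α : ℂ) * Λ := by rw [← Complex.ofReal_mul, h]
  have hα' : (α : ℂ) ≠ 0 := by exact_mod_cast hα
  have hΛ : Λ ≠ 0 := by intro hz; rw [hz, mul_zero] at h; exact Real.pi_ne_zero h.symm
  have hΛ' : (Λ : ℂ) ≠ 0 := by exact_mod_cast hΛ
  have hI : I ≠ 0 := I_ne_zero
  have hE : cexp (betaMain (3/2) α * ((0.498 : ℂ) * Λ)) = cexp (0.747 * π * I) := by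
    congr 1; unfold betaMain; rw [hπ]; push_cast; ring
  unfold appBMain
  rw [hE]
  unfold e3j betaMain
  rw [hπ]
  generalize cexp (0.747 * ((α : ℂ) * Λ) * I) = w
  push_cast
  field_simp
  ring

/-- The displayed `μ = 2` residue at `s = 0`: `−β_j/(β₇² log P₂) = −8j/(25πi)` at the main values
(the manuscript adds `+ O(α₁)` for `β_j − β_j⁰`). [cite: Zhang2022LandauSiegel, Appendix B] -/
theorem appBResZero_main_mu2 (hα : α ≠ 0) (h : α * Λ = π) (j : ℕ) :
    appBResZero (betaMain j α) (betaMain (5/2) α) ((0.5 : ℂ) * Λ) = -(8 * (j : ℂ) / (25 * π * I)) := by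
  have hπ : (π : ℂ) = (α : ℂ) * Λ := by rw [← Complex.ofReal_mul, h]
  have hα' : (α : ℂ) ≠ 0 := by exact_mod_cast hα
  have hΛ : Λ ≠ 0 := by intro hz; rw [hz, mul_zero] at h; exact Real.pi_ne_zero h.symm
  have hΛ' : (Λ : ℂ) ≠ 0 := by exact_mod_cast hΛ
  have hI : I ≠ 0 := I_ne_zero
  unfold appBResZero betaMain
  rw [hπ]
  push_cast
  field_simp
  ring

/-- The displayed `μ = 2` residue at `s = β₇`: `(1 − 2j/5 + 8j/(25πi)) exp{5πi/4}` at the main values.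
[cite: Zhang2022LandauSiegel, Appendix B] -/
theorem appBResBeta_main_mu2 (hα : α ≠ 0) (h : α * Λ = π) (j : ℕ) :
    appBResBeta (betaMain j α) (betaMain (5/2) α) ((0.5 : ℂ) * Λ)
      = (1 - 2 * (j : ℂ) / 5 + 8 * (j : ℂ) / (25 * π * I)) * cexp (5 * π * I / 4) := by
  have hπ : (π : ℂ) = (α : ℂ) * Λ := by rw [← Complex.ofReal_mul, h]
  have hα' : (α : ℂ) ≠ 0 := by exact_mod_cast hα
  have hΛ : Λ ≠ 0 := by intro hz; rw [hz, mul_zero] at h; exact Real.pi_ne_zero h.symm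
  have hΛ' : (Λ : ℂ) ≠ 0 := by exact_mod_cast hΛ
  have hI : I ≠ 0 := I_ne_zero
  have hE : cexp (betaMain (5/2) α * ((0.5 : ℂ) * Λ)) = cexp (5 * π * I / 4) := by
    congr 1; unfold betaMain; rw [hπ]; push_cast; ring
  unfold appBResBeta
  rw [hE]
  unfold betaMain
  rw [hπ]
  generalize cexp (5 * ((α : ℂ) * Λ) * I / 4) = w
  push_cast
  field_simp
  ring

/-- **`μ = 1` end to end**: on the manuscript's circle `|s| = 5α` (`α > 0`), with `x = P₁ = P^{0.504}`,
`(2πi)⁻¹ ∮ P₁ˢ (s − β_j)/((log P₁) s (s − β₆)²) ds = e′_{1j}` at the main values.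
[cite: Zhang2022LandauSiegel, Appendix B, Lemma 15.1] -/
theorem appB_main_e1pj (hα : 0 < α) (h : α * Λ = π) (j : ℕ) :
    (2 * π * I)⁻¹ * (∮ s in C((0 : ℂ), 5 * α), cexp (s * ((0.504 : ℂ) * Λ)) * (s - betaMain j α)
      / (((0.504 : ℂ) * Λ) * s * (s - betaMain (3/2) α) ^ 2)) = e1pj j := by
  have hΛ : Λ ≠ 0 := by intro hz; rw [hz, mul_zero] at h; exact Real.pi_ne_zero h.symm
  have hL : (0.504 : ℂ) * Λ ≠ 0 := mul_ne_zero (by norm_num) (by exact_mod_cast hΛ)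
  rw [circleIntegral_appB _ _ _ (mem_ball_self (by positivity)) (betaMain_mem_ball (by norm_num) hα)
      (betaMain_ne_zero (by norm_num) hα.ne') hL, appBMain_main_e1pj hα.ne' h]

/-- **`μ = 2` end to end**: `(2πi)⁻¹ ∮_{|s| = 5α} P₂ˢ (s − β_j)/((log P₂) s (s − β₇)²) ds = e_{2j}` at the
main values (`log P₂ ↦ 0.5 log P`). [cite: Zhang2022LandauSiegel, Appendix B, Lemma 15.1] -/
theorem appB_main_e2j (hα : 0 < α) (h : α * Λ = π) (j : ℕ) :
    (2 * π * I)⁻¹ * (∮ s in C((0 : ℂ), 5 * α), cexp (s * ((0.5 : ℂ) * Λ)) * (s - betaMain j α)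
      / (((0.5 : ℂ) * Λ) * s * (s - betaMain (5/2) α) ^ 2)) = e2j j := by
  have hΛ : Λ ≠ 0 := by intro hz; rw [hz, mul_zero] at h; exact Real.pi_ne_zero h.symm
  have hL : (0.5 : ℂ) * Λ ≠ 0 := mul_ne_zero (by norm_num) (by exact_mod_cast hΛ)
  rw [circleIntegral_appB _ _ _ (mem_ball_self (by positivity)) (betaMain_mem_ball (by norm_num) hα)
      (betaMain_ne_zero (by norm_num) hα.ne') hL, appBMain_main_e2j hα.ne' h]

/-- **`μ = 3` end to end**: `(2πi)⁻¹ ∮_{|s| = 5α} P₃ˢ (s − β_j)/((log P₃) s (s − β₆)²) ds = e_{3j}` at the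
main values. [cite: Zhang2022LandauSiegel, Appendix B, Lemma 15.1] -/
theorem appB_main_e3j (hα : 0 < α) (h : α * Λ = π) (j : ℕ) :
    (2 * π * I)⁻¹ * (∮ s in C((0 : ℂ), 5 * α), cexp (s * ((0.498 : ℂ) * Λ)) * (s - betaMain j α)
      / (((0.498 : ℂ) * Λ) * s * (s - betaMain (3/2) α) ^ 2)) = e3j j := by
  have hΛ : Λ ≠ 0 := by intro hz; rw [hz, mul_zero] at h; exact Real.pi_ne_zero h.symm
  have hL : (0.498 : ℂ) * Λ ≠ 0 := mul_ne_zero (by norm_num) (by exact_mod_cast hΛ)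
  rw [circleIntegral_appB _ _ _ (mem_ball_self (by positivity)) (betaMain_mem_ball (by norm_num) hα)
      (betaMain_ne_zero (by norm_num) hα.ne') hL, appBMain_main_e3j hα.ne' h]

end MainValues

/-! ### Window averages: `e′_{1j}`, `e_{3j}`, `e_{2j}` as means of the §8 profiles -/

/-- Closed form of `∫₀ᴸ 𝔣𝔣_{a,k}(z) dz` (`k ≠ 0`):
`ffFInt a k L = ((1 − a/k + aπiL) e^{kπiL} − (1 − a/k))/(kπi)`. [folklore] -/
def ffFInt (a k : ℚ) (L : ℝ) : ℂ :=
  ((1 - (a : ℂ) / k + a * π * I * L) * cexp (k * π * I * L) - (1 - (a : ℂ) / k)) / (k * π * I)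

/-- `∫₀ᴸ 𝔣𝔣_{a,k}(z) dz = ffFInt a k L` (`k ≠ 0`; fundamental theorem of calculus with the antiderivative
`(1 − a/k + aπiz) e^{kπiz}/(kπi)`). [folklore] -/
theorem integral_ffF_closed (a k : ℚ) (hk : k ≠ 0) (L : ℝ) :
    ∫ z in (0:ℝ)..L, ffF a k z = ffFInt a k L := by
  have hk' : (k : ℂ) ≠ 0 := by exact_mod_cast hk
  have hπ : (π : ℂ) ≠ 0 := by exact_mod_cast Real.pi_ne_zero
  have hI : I ≠ 0 := I_ne_zero
  have hderiv : ∀ z : ℝ, HasDerivAt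
      (fun x : ℝ => (1 - (a : ℂ) / k + a * π * I * x) * cexp (k * π * I * x) / (k * π * I))
      (ffF a k z) z := by
    intro z
    have h1 : HasDerivAt (fun x : ℝ => (x : ℂ)) 1 z := by
      simpa using (hasDerivAt_id z).ofReal_comp
    have hP : HasDerivAt (fun x : ℝ => (1 - (a : ℂ) / k + a * π * I * x)) ((a : ℂ) * π * I) z :=
      ((h1.const_mul ((a : ℂ) * π * I)).const_add (1 - (a : ℂ) / k)).congr_deriv (by ring)
    have hE : HasDerivAt (fun x : ℝ => cexp (k * π * I * x)) (cexp (k * π * I * z) * (k * π * I)) z :=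
      ((h1.const_mul ((k : ℂ) * π * I)).cexp).congr_deriv (by ring)
    refine ((hP.fun_mul hE).div_const ((k : ℂ) * π * I)).congr_deriv ?_
    unfold ffF
    field_simp
    ring
  rw [intervalIntegral.integral_eq_sub_of_hasDerivAt (fun z _ => hderiv z)
      ((continuous_ffF a k).intervalIntegrable _ _)]
  unfold ffFInt
  simp only [Complex.ofReal_zero, mul_zero, Complex.exp_zero, mul_one, add_zero]
  ring

/-- **`e′_{1j}` is the mean of `𝔣𝔣_{j6} = 𝔣𝔣_{3/2−j, 3/2}` over the `P₁`-window `[0, 0.504]`**: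
`e′_{1j} = (1/0.504)∫₀^{0.504} 𝔣𝔣_{j6}(z) dz` ((8.13)–(8.15): `𝔣𝔣₁₆, 𝔣𝔣₂₆, 𝔣𝔣₃₆ = ffF (1/2), (−1/2),
(−3/2)` with `k = 3/2`). [cite: Zhang2022LandauSiegel, Lemma 15.1, (8.13)–(8.15), (4.1)] -/
theorem e1pj_eq_average (j : ℕ) :
    e1pj j = ((1 / 0.504 : ℝ) : ℂ) * ∫ z in (0:ℝ)..0.504, ffF (3/2 - j) (3/2) z := by
  rw [integral_ffF_closed _ _ (by norm_num)]
  have hπ : (π : ℂ) ≠ 0 := by exact_mod_cast Real.pi_ne_zero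
  have hI : I ≠ 0 := I_ne_zero
  have hE : cexp ((((3/2 : ℚ)) : ℂ) * π * I * ((0.504 : ℝ) : ℂ)) = cexp (0.756 * π * I) := by
    congr 1; push_cast; ring
  unfold e1pj ffFInt
  rw [hE]
  generalize cexp (0.756 * π * I) = w
  push_cast
  field_simp
  ring

/-- **`e_{3j}` is the mean of `𝔣𝔣_{j6}` over the `P₃`-window `[0, 0.498]`**:
`e_{3j} = (1/0.498)∫₀^{0.498} 𝔣𝔣_{j6}(z) dz`. [cite: Zhang2022LandauSiegel, Lemma 15.1, (8.13)–(8.15), (4.3)] -/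
theorem e3j_eq_average (j : ℕ) :
    e3j j = ((1 / 0.498 : ℝ) : ℂ) * ∫ z in (0:ℝ)..0.498, ffF (3/2 - j) (3/2) z := by
  rw [integral_ffF_closed _ _ (by norm_num)]
  have hπ : (π : ℂ) ≠ 0 := by exact_mod_cast Real.pi_ne_zero
  have hI : I ≠ 0 := I_ne_zero
  have hE : cexp ((((3/2 : ℚ)) : ℂ) * π * I * ((0.498 : ℝ) : ℂ)) = cexp (0.747 * π * I) := by
    congr 1; push_cast; ring
  unfold e3j ffFInt
  rw [hE]
  generalize cexp (0.747 * π * I) = w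
  push_cast
  field_simp
  ring

/-- **`e_{2j}` is the mean of `𝔣𝔣_{j7} = 𝔣𝔣_{5/2−j, 5/2}` over the `P₂`-window `[0, 0.5]`**:
`e_{2j} = (1/0.5)∫₀^{0.5} 𝔣𝔣_{j7}(z) dz` ((8.16)–(8.18): `𝔣𝔣₁₇, 𝔣𝔣₂₇, 𝔣𝔣₃₇ = ffF (3/2), (1/2), (−1/2)`
with `k = 5/2`). [cite: Zhang2022LandauSiegel, Lemma 15.1, (8.16)–(8.18), (4.2)] -/
theorem e2j_eq_average (j : ℕ) :
    e2j j = ((1 / 0.5 : ℝ) : ℂ) * ∫ z in (0:ℝ)..0.5, ffF (5/2 - j) (5/2) z := by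
  rw [integral_ffF_closed _ _ (by norm_num)]
  have hπ : (π : ℂ) ≠ 0 := by exact_mod_cast Real.pi_ne_zero
  have hI : I ≠ 0 := I_ne_zero
  have hE : cexp ((((5/2 : ℚ)) : ℂ) * π * I * ((0.5 : ℝ) : ℂ)) = cexp (5 * π * I / 4) := by
    congr 1; push_cast; ring
  unfold e2j ffFInt
  rw [hE]
  generalize cexp (5 * π * I / 4) = w
  push_cast
  field_simp
  ring

/-! ### (B.3): the value the proof derives, and its closed form `−jπi·b*` -/

/-- **(B.3), derived value.** The LAST display of the proof of (B.3),
`(1/0.504)(β_j/β₆)∫_{0.5}^{0.504}(P^{β₆(0.504−z)} − P^{0.004β₆}) dz`, at the main values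
(`β_j/β₆ = 2j/3`, `P^{β₆w} = e^{(3/2)wπi}`):
`e1ppD j = (1/0.504)(2j/3)∫_{0.5}^{0.504}(e^{(3/2)(0.504−z)πi} − e^{(3/2)(0.004)πi}) dz`.
(The STATED (B.3) / Lemma 15.1 print instead `e1ppj j = (j/0.756)∫₀^{0.004}(e^{(3/2)(0.504−z)πi} −
e^{(3/4)πi})dz`, a different number.) [cite: Zhang2022LandauSiegel, Appendix B (B.3), last display] -/
def e1ppD (j : ℕ) : ℂ :=
  ((1 / 0.504 : ℝ) : ℂ) * (2 * (j : ℂ) / 3) *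
    ∫ z in (0.5:ℝ)..0.504, (cexp (3 / 2 * (0.504 - z) * π * I) - cexp (3 / 2 * 0.004 * π * I))

section B3

variable {α Λ : ℝ}

/-- The last display of the proof of (B.3), written with the shifts `β_j⁰ = jiα`, `β₆ = 3iα/2` and
`P^{w} = e^{w log P}`, `α log P = π`, equals `e1ppD j`. [cite: Zhang2022LandauSiegel, Appendix B (B.3)] -/
theorem appB3_main (hα : α ≠ 0) (h : α * Λ = π) (j : ℕ) :
    ((1 / 0.504 : ℝ) : ℂ) * (betaMain j α / betaMain (3/2) α) *
        (∫ z in (0.5:ℝ)..0.504, (cexp (betaMain (3/2) α * ((0.504 - z) * Λ))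
          - cexp (betaMain (3/2) α * ((0.004 : ℝ) * Λ))))
      = e1ppD j := by
  have hπ : (π : ℂ) = (α : ℂ) * Λ := by rw [← Complex.ofReal_mul, h]
  have hα' : (α : ℂ) ≠ 0 := by exact_mod_cast hα
  have hI : I ≠ 0 := I_ne_zero
  have hq : betaMain j α / betaMain (3/2) α = 2 * (j : ℂ) / 3 := by
    unfold betaMain; push_cast; field_simp
  have hint : (∫ z in (0.5:ℝ)..0.504, (cexp (betaMain (3/2) α * ((0.504 - z) * Λ))
          - cexp (betaMain (3/2) α * ((0.004 : ℝ) * Λ))))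
      = ∫ z in (0.5:ℝ)..0.504, (cexp (3 / 2 * (0.504 - z) * π * I) - cexp (3 / 2 * 0.004 * π * I)) := by
    refine intervalIntegral.integral_congr (fun z _ => ?_)
    rw [hπ]
    unfold betaMain
    push_cast
    congr 1 <;> (congr 1; ring)
  unfold e1ppD
  rw [hq, hint]

end B3

/-- **`e1ppD j = −jπi·b*`** (`b* = (1/0.504)∫₀^{0.004} z e^{3πiz/2} dz`, (12.10)): substitute
`z ↦ 0.504 − z`, then integrate by parts
(`∫₀ᵃ (e^{mv} − e^{ma}) dv = −m∫₀ᵃ v e^{mv} dv`, `m = 3πi/2`, `a = 0.004`), and `(2j/3)·(3πi/2) = jπi`.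
[cite: Zhang2022LandauSiegel, Appendix B (B.3), (12.10)] -/
theorem e1ppD_eq (j : ℕ) : e1ppD j = -((j : ℂ) * π * I) * bstar := by
  -- Step 1: the substitution `z ↦ 0.504 − z`.
  have hsub := intervalIntegral.integral_comp_sub_left
    (fun v : ℝ => cexp (3 / 2 * π * I * v) - cexp (3 / 2 * π * I * (0.004 : ℝ))) (0.504 : ℝ)
    (a := (0.5 : ℝ)) (b := (0.504 : ℝ))
  rw [sub_self, show (0.504 : ℝ) - 0.5 = 0.004 by norm_num] at hsub
  have h1 : (∫ z in (0.5:ℝ)..0.504, (cexp (3 / 2 * (0.504 - z) * π * I) - cexp (3 / 2 * 0.004 * π * I)))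
      = ∫ v in (0:ℝ)..0.004, (cexp (3 / 2 * π * I * v) - cexp (3 / 2 * π * I * (0.004 : ℝ))) := by
    rw [← hsub]
    refine intervalIntegral.integral_congr (fun z _ => ?_)
    push_cast
    congr 1 <;> (congr 1; ring)
  -- Step 2: integration by parts via the antiderivative `v ↦ v (e^{mv} − e^{ma})`.
  have hderiv : ∀ v : ℝ, HasDerivAt
      (fun x : ℝ => (x : ℂ) * (cexp (3 / 2 * π * I * x) - cexp (3 / 2 * π * I * (0.004 : ℝ))))
      ((cexp (3 / 2 * π * I * v) - cexp (3 / 2 * π * I * (0.004 : ℝ)))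
        + 3 / 2 * π * I * ((v : ℂ) * cexp (3 / 2 * π * I * v))) v := by
    intro v
    have h1 : HasDerivAt (fun x : ℝ => (x : ℂ)) 1 v := by
      simpa using (hasDerivAt_id v).ofReal_comp
    have hE : HasDerivAt (fun x : ℝ => cexp (3 / 2 * π * I * x) - cexp (3 / 2 * π * I * (0.004 : ℝ)))
        (cexp (3 / 2 * π * I * v) * (3 / 2 * π * I)) v :=
      (((h1.const_mul (3 / 2 * (π : ℂ) * I)).cexp).sub_const _).congr_deriv (by ring)
    exact (h1.fun_mul hE).congr_deriv (by ring)
  have hzero : (∫ v in (0:ℝ)..0.004, ((cexp (3 / 2 * π * I * v) - cexp (3 / 2 * π * I * (0.004 : ℝ)))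
        + 3 / 2 * π * I * ((v : ℂ) * cexp (3 / 2 * π * I * v)))) = 0 := by
    rw [intervalIntegral.integral_eq_sub_of_hasDerivAt (fun v _ => hderiv v)
        (Continuous.intervalIntegrable (by fun_prop) _ _)]
    simp
  have hparts : (∫ v in (0:ℝ)..0.004, (cexp (3 / 2 * π * I * v) - cexp (3 / 2 * π * I * (0.004 : ℝ))))
      = -(3 / 2 * π * I) * ∫ v in (0:ℝ)..0.004, (v : ℂ) * cexp (3 / 2 * π * I * v) := by
    rw [intervalIntegral.integral_add (Continuous.intervalIntegrable (by fun_prop) _ _)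
        (Continuous.intervalIntegrable (by fun_prop) _ _), intervalIntegral.integral_const_mul] at hzero
    linear_combination hzero
  have hb : (∫ v in (0:ℝ)..0.004, (v : ℂ) * cexp (3 / 2 * π * I * v))
      = ∫ z in (0:ℝ)..0.004, (z : ℂ) * cexp (3 * π * I * z / 2) := by
    refine intervalIntegral.integral_congr (fun z _ => ?_)
    congr 2
    ring
  unfold e1ppD bstar
  rw [h1, hparts, hb]
  push_cast
  ring

/-- Hence `β_j/β₆ · (1/0.504)∫_{0.5}^{0.504}(P^{β₆(0.504−z)} − P^{0.004β₆})dz = −jπi·b*` at the main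
values: the quantity the proof of (B.3) arrives at is `−jπi b*`, for every `j`.
[cite: Zhang2022LandauSiegel, Appendix B (B.3), (12.10)] -/
theorem appB3_main_eq_bstar {α Λ : ℝ} (hα : α ≠ 0) (h : α * Λ = π) (j : ℕ) :
    ((1 / 0.504 : ℝ) : ℂ) * (betaMain j α / betaMain (3/2) α) *
        (∫ z in (0.5:ℝ)..0.504, (cexp (betaMain (3/2) α * ((0.504 - z) * Λ))
          - cexp (betaMain (3/2) α * ((0.004 : ℝ) * Λ))))
      = -((j : ℂ) * π * I) * bstar := by
  rw [appB3_main hα h, e1ppD_eq]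

end Literature.NumberTheory.LFunctions.Zhang2022
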